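import Summits.CriticalPhenomena.Ising3DConformalLimit.Theses.SynchronousCoupling
import Literature.Probability.LatticeModels.GibbsSpecification
import HarnessLib

/-!
# Line `Sketch` for the crux `SynchronousCoupling.DilationJoinings` (stmt-CriticalPhenomena-18762) — stub `stub_unitDefect`

Hilbert-space step of the line: for a coupling `π` of a probability measure `μ` with itself and two
finite sets of sites `A`, `B` with positive block second moments, an AMPLITUDE-FREE mismatch bound
`∫ (r S_A(q.1) − S_B(q.2))² dπ ≤ e · ∫ S_B² dμ` (`r ≥ 0`) gives the SELF-NORMALISED defect
`∫ (S_A(q.1)/N_A − S_B(q.2)/N_B)² dπ ≤ 4 e`, `N_• = √∫ S_•² dμ`.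

Proof: with `a² = ∫ X² dπ`, `b² = ∫ Y² dπ`, `c = ∫ X Y dπ`, `ĉ = c/(ab) ∈ [-1, 1]`, `s = r a / b ≥ 0`,
the hypothesis reads `s² − 2 s ĉ + 1 ≤ e` and the goal `2 − 2 ĉ ≤ 4 e`; elementary.
The block sums are bounded (`|σ_x| = 1`) and measurable, so all second moments exist, and the
marginal identities `π.fst = π.snd = μ` transport `∫ S_A² dμ`, `∫ S_B² dμ` to `π`.

Helper file of the line `Sketch` (lead skeleton `Cruxes/DilationJoinings/Lines/Sketch.lean`): proves the
registered stub `stub_unitDefect` verbatim (name + signature). No definitions, no named facts, no sorry.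
-/

noncomputable section

namespace Summit.CriticalPhenomena.Ising3DConformalLimit.Cruxes.DilationJoinings.Sketch

open MeasureTheory Literature.Probability.LatticeModels

/-- Scalar core: for `s ≥ 0`, `t ∈ [-1, 1]`, `s² − 2 s t + 1 ≤ e` implies `2 − 2 t ≤ 4 e`
(if `t ≥ 0`: `e ≥ 1 − t² ≥ 1 − t ≥ 0`; if `t < 0`: `e ≥ 1` and `2 − 2 t ≤ 4`). -/
private theorem scalar_core {s t e : ℝ} (hs : 0 ≤ s) (ht1 : -1 ≤ t) (ht2 : t ≤ 1)
    (h : s ^ 2 - 2 * s * t + 1 ≤ e) : 2 - 2 * t ≤ 4 * e := by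
  rcases le_or_gt 0 t with ht | ht
  · nlinarith [sq_nonneg (s - t), mul_nonneg ht (sub_nonneg.2 ht2)]
  · nlinarith [mul_nonneg hs (neg_nonneg.2 ht.le), sq_nonneg s]

/-- Scalar step in the raw variables produced by expanding the three squares: `a, b > 0` the two
norms (`a² = a2`, `b² = b2`), `c = ∫ X Y`, amplitude `r ≥ 0`. -/
private theorem scalar_step {a b r c e a2 b2 : ℝ} (ha : 0 < a) (hb : 0 < b) (haa : a ^ 2 = a2)
    (hbb : b ^ 2 = b2) (hr : 0 ≤ r)
    (hN1 : 0 ≤ a⁻¹ ^ 2 * a2 - 2 * a⁻¹ * b⁻¹ * c + b⁻¹ ^ 2 * b2)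
    (hN2 : 0 ≤ a⁻¹ ^ 2 * a2 - 2 * a⁻¹ * (-b⁻¹) * c + (-b⁻¹) ^ 2 * b2)
    (hH : r ^ 2 * a2 - 2 * r * 1 * c + 1 ^ 2 * b2 ≤ e * b2) :
    a⁻¹ ^ 2 * a2 - 2 * a⁻¹ * b⁻¹ * c + b⁻¹ ^ 2 * b2 ≤ 4 * e := by
  subst haa hbb
  have ha0 : a ≠ 0 := ha.ne'
  have hb0 : b ≠ 0 := hb.ne'
  have h1 : a⁻¹ ^ 2 * a ^ 2 = 1 := by rw [inv_pow, inv_mul_cancel₀ (pow_ne_zero 2 ha0)]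
  have h2 : b⁻¹ ^ 2 * b ^ 2 = 1 := by rw [inv_pow, inv_mul_cancel₀ (pow_ne_zero 2 hb0)]
  have h2' : (-b⁻¹) ^ 2 * b ^ 2 = 1 := by rw [neg_sq, h2]
  rw [h1, h2] at hN1 ⊢
  rw [h1, h2'] at hN2
  have key : (r * a * b⁻¹) ^ 2 - 2 * (r * a * b⁻¹) * (a⁻¹ * b⁻¹ * c) + 1 ≤ e := by
    have hb2 : 0 < b ^ 2 := pow_pos hb 2
    refine le_of_mul_le_mul_right ?_ hb2
    have : ((r * a * b⁻¹) ^ 2 - 2 * (r * a * b⁻¹) * (a⁻¹ * b⁻¹ * c) + 1) * b ^ 2 =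
        r ^ 2 * a ^ 2 - 2 * r * 1 * c + 1 ^ 2 * b ^ 2 := by
      field_simp
    rw [this]
    exact hH
  have hs : 0 ≤ r * a * b⁻¹ := mul_nonneg (mul_nonneg hr ha.le) (inv_nonneg.2 hb.le)
  have hc1 : a⁻¹ * b⁻¹ * c ≤ 1 := by linarith
  have hc2 : -1 ≤ a⁻¹ * b⁻¹ * c := by linarith
  linarith [scalar_core hs hc2 hc1 key]

/-- A measurable real function bounded in absolute value is integrable against a finite measure. -/
private theorem integrable_of_abs_le {Ω : Type*} [MeasurableSpace Ω] {π : Measure Ω}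
    [IsFiniteMeasure π] {f : Ω → ℝ} (hf : Measurable f) (C : ℝ) (hC : ∀ ω, |f ω| ≤ C) :
    Integrable f π :=
  Integrable.of_bound hf.aestronglyMeasurable C
    (ae_of_all _ fun ω => by rw [Real.norm_eq_abs]; exact hC ω)

/-- Expansion of the square: `∫ (α X − β Y)² = α² ∫ X² − 2 α β ∫ X Y + β² ∫ Y²` when the three
second moments exist. -/
private theorem integral_sub_sq_expand {Ω : Type*} [MeasurableSpace Ω] {π : Measure Ω}
    {X Y : Ω → ℝ} (hX2 : Integrable (fun ω => X ω ^ 2) π) (hY2 : Integrable (fun ω => Y ω ^ 2) π)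
    (hXY : Integrable (fun ω => X ω * Y ω) π) (α β : ℝ) :
    ∫ ω, (α * X ω - β * Y ω) ^ 2 ∂π =
      α ^ 2 * ∫ ω, X ω ^ 2 ∂π - 2 * α * β * ∫ ω, X ω * Y ω ∂π + β ^ 2 * ∫ ω, Y ω ^ 2 ∂π := by
  have h : (fun ω => (α * X ω - β * Y ω) ^ 2) =
      fun ω => (α ^ 2 * X ω ^ 2 - 2 * α * β * (X ω * Y ω)) + β ^ 2 * Y ω ^ 2 := by
    funext ω; ring
  have h1 : Integrable (fun ω => α ^ 2 * X ω ^ 2) π := hX2.const_mul _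
  have h2 : Integrable (fun ω => 2 * α * β * (X ω * Y ω)) π := hXY.const_mul _
  have h3 : Integrable (fun ω => β ^ 2 * Y ω ^ 2) π := hY2.const_mul _
  have h12 : Integrable (fun ω => α ^ 2 * X ω ^ 2 - 2 * α * β * (X ω * Y ω)) π := h1.sub h2
  rw [h, integral_add h12 h3, integral_sub h1 h2, integral_const_mul, integral_const_mul,
    integral_const_mul]

/-- Abstract form of the stub: two bounded measurable real functions `X`, `Y` on a finite measure
space with positive second moments `a2 = ∫ X²`, `b2 = ∫ Y²`; if `∫ (r X − Y)² ≤ e · b2` for some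
`r ≥ 0` then `∫ (X/√a2 − Y/√b2)² ≤ 4 e`. -/
private theorem unitDefect_abstract {Ω : Type*} [MeasurableSpace Ω] {π : Measure Ω}
    [IsFiniteMeasure π] {X Y : Ω → ℝ} (hX : Measurable X) (hY : Measurable Y) {CX CY : ℝ}
    (hXb : ∀ ω, |X ω| ≤ CX) (hYb : ∀ ω, |Y ω| ≤ CY) {a2 b2 r e : ℝ}
    (ha2 : ∫ ω, X ω ^ 2 ∂π = a2) (hb2 : ∫ ω, Y ω ^ 2 ∂π = b2) (ha : 0 < a2) (hb : 0 < b2)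
    (hr : 0 ≤ r) (hyp : ∫ ω, (r * X ω - Y ω) ^ 2 ∂π ≤ e * b2) :
    ∫ ω, ((Real.sqrt a2)⁻¹ * X ω - (Real.sqrt b2)⁻¹ * Y ω) ^ 2 ∂π ≤ 4 * e := by
  have hX2 : Integrable (fun ω => X ω ^ 2) π :=
    integrable_of_abs_le (hX.pow_const 2) (CX ^ 2) fun ω => by
      rw [abs_pow]; exact pow_le_pow_left₀ (abs_nonneg _) (hXb ω) 2
  have hY2 : Integrable (fun ω => Y ω ^ 2) π :=
    integrable_of_abs_le (hY.pow_const 2) (CY ^ 2) fun ω => by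
      rw [abs_pow]; exact pow_le_pow_left₀ (abs_nonneg _) (hYb ω) 2
  have hXY : Integrable (fun ω => X ω * Y ω) π :=
    integrable_of_abs_le (hX.mul hY) (CX * CY) fun ω => by
      rw [abs_mul]
      exact mul_le_mul (hXb ω) (hYb ω) (abs_nonneg _) ((abs_nonneg _).trans (hXb ω))
  have E := integral_sub_sq_expand hX2 hY2 hXY
  have ha' : 0 < Real.sqrt a2 := Real.sqrt_pos.2 ha
  have hb' : 0 < Real.sqrt b2 := Real.sqrt_pos.2 hb
  have haa : Real.sqrt a2 ^ 2 = a2 := Real.sq_sqrt ha.le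
  have hbb : Real.sqrt b2 ^ 2 = b2 := Real.sq_sqrt hb.le
  have hN1 : 0 ≤ (Real.sqrt a2)⁻¹ ^ 2 * a2 - 2 * (Real.sqrt a2)⁻¹ * (Real.sqrt b2)⁻¹ *
      ∫ ω, X ω * Y ω ∂π + (Real.sqrt b2)⁻¹ ^ 2 * b2 := by
    have h0 : 0 ≤ ∫ ω, ((Real.sqrt a2)⁻¹ * X ω - (Real.sqrt b2)⁻¹ * Y ω) ^ 2 ∂π :=
      integral_nonneg fun ω => sq_nonneg _
    rw [E, ha2, hb2] at h0
    exact h0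
  have hN2 : 0 ≤ (Real.sqrt a2)⁻¹ ^ 2 * a2 - 2 * (Real.sqrt a2)⁻¹ * (-(Real.sqrt b2)⁻¹) *
      ∫ ω, X ω * Y ω ∂π + (-(Real.sqrt b2)⁻¹) ^ 2 * b2 := by
    have h0 : 0 ≤ ∫ ω, ((Real.sqrt a2)⁻¹ * X ω - (-(Real.sqrt b2)⁻¹) * Y ω) ^ 2 ∂π :=
      integral_nonneg fun ω => sq_nonneg _
    rw [E, ha2, hb2] at h0
    exact h0
  have hH : r ^ 2 * a2 - 2 * r * 1 * ∫ ω, X ω * Y ω ∂π + 1 ^ 2 * b2 ≤ e * b2 := by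
    have h0 := E r 1
    rw [ha2, hb2] at h0
    rw [← h0]
    simpa only [one_mul] using hyp
  rw [E, ha2, hb2]
  exact scalar_step ha' hb' haa hbb hr hN1 hN2 hH

/-- **Stub `stub_unitDefect`** of the line `Sketch` (crux stmt-CriticalPhenomena-18762): for a
coupling `π` of a probability measure `μ` with itself and two finite sets of sites `A`, `B` with
positive block second moments, if `∫ (r S_A(q.1) − S_B(q.2))² dπ ≤ e · ∫ S_B² dμ` for some `r ≥ 0`,
then the self-normalised defect `∫ (S_A(q.1)/N_A − S_B(q.2)/N_B)² dπ ≤ 4 e`, `N_• = √∫ S_•² dμ`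
(unit vectors `â`, `b̂` and `s ≥ 0`: `‖â − b̂‖² = 2 − 2⟨â, b̂⟩ ≤ 4 ‖s â − b̂‖²`). -/
theorem stub_unitDefect :
    ∀ (μ : Measure (SpinConfig (Site 3))) (π : Measure (SpinConfig (Site 3) × SpinConfig (Site 3)))
      (A B : Finset (Site 3)) (r e : ℝ), IsProbabilityMeasure μ → π.fst = μ → π.snd = μ → 0 ≤ r →
      0 < ∫ σ, (∑ x ∈ A, spinAt x σ) ^ 2 ∂μ → 0 < ∫ σ, (∑ x ∈ B, spinAt x σ) ^ 2 ∂μ →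
      ∫ q, (r * (∑ x ∈ A, spinAt x q.1) - (∑ x ∈ B, spinAt x q.2)) ^ 2 ∂π
          ≤ e * ∫ σ, (∑ x ∈ B, spinAt x σ) ^ 2 ∂μ →
      ∫ q, ((Real.sqrt (∫ σ, (∑ x ∈ A, spinAt x σ) ^ 2 ∂μ))⁻¹ * (∑ x ∈ A, spinAt x q.1)
          - (Real.sqrt (∫ σ, (∑ x ∈ B, spinAt x σ) ^ 2 ∂μ))⁻¹ * (∑ x ∈ B, spinAt x q.2)) ^ 2 ∂π
        ≤ 4 * e := by
  intro μ π A B r e hμ hfst hsnd hr hA hB hyp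
  haveI : IsProbabilityMeasure π :=
    ⟨by rw [← Measure.fst_univ, hfst]; exact measure_univ⟩
  have hmA : Measurable fun σ : SpinConfig (Site 3) => ∑ x ∈ A, spinAt x σ :=
    Finset.measurable_sum A fun x _ => measurable_spinAt x
  have hmB : Measurable fun σ : SpinConfig (Site 3) => ∑ x ∈ B, spinAt x σ :=
    Finset.measurable_sum B fun x _ => measurable_spinAt x
  have hbd : ∀ (S : Finset (Site 3)) (σ : SpinConfig (Site 3)),
      |∑ x ∈ S, spinAt x σ| ≤ (S.card : ℝ) := by
    intro S σ
    calc |∑ x ∈ S, spinAt x σ| ≤ ∑ x ∈ S, |spinAt x σ| := Finset.abs_sum_le_sum_abs _ _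
      _ = (S.card : ℝ) := by simp [abs_spinAt]
  have hXa : ∫ q, (∑ x ∈ A, spinAt x q.1) ^ 2 ∂π = ∫ σ, (∑ x ∈ A, spinAt x σ) ^ 2 ∂μ := by
    rw [← hfst, Measure.fst, integral_map measurable_fst.aemeasurable
      (hmA.pow_const 2).aestronglyMeasurable]
  have hYb : ∫ q, (∑ x ∈ B, spinAt x q.2) ^ 2 ∂π = ∫ σ, (∑ x ∈ B, spinAt x σ) ^ 2 ∂μ := by
    rw [← hsnd, Measure.snd, integral_map measurable_snd.aemeasurable
      (hmB.pow_const 2).aestronglyMeasurable]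
  exact unitDefect_abstract (π := π) (X := fun q => ∑ x ∈ A, spinAt x q.1)
    (Y := fun q => ∑ x ∈ B, spinAt x q.2) (hmA.comp measurable_fst) (hmB.comp measurable_snd)
    (fun q => hbd A q.1) (fun q => hbd B q.2) hXa hYb hA hB hr hyp

end Summit.CriticalPhenomena.Ising3DConformalLimit.Cruxes.DilationJoinings.Sketch

end
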